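import Summits.Schanuel.Schanuel.Theorems.ZilberEacGraphCurveEscape
import HarnessLib

/-!
# Graph base × curve, VI-a: coefficient tails and a polynomial-times-exponential decay

HONEST FRAMING.  Cell `pub-schanuel` (Zilber's Exponential-Algebraic Closedness, case ladder;
host summit Schanuel), seat 2, gen 16.  Elementary lemmas for the escape engine with POLYNOMIAL
coefficients (`ZilberEacGraphCurveEscapePoly.exists_escape_zeros_poly`, non-split surfaces over
graph bases): the tail `q(z) - [zⁿ]q zⁿ` of a polynomial of degree `≤ n`, the coefficient ratio
`q(z)/z₀ⁿ - [zⁿ]q` in the local coordinate (`‖z - z₀‖ ≤ 1`), and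
`(2 + 3Λ)^N e^{δ(1 - 3Λ/16)} → 0`.  NOT Schanuel's conjecture; `EC(3,2)` stays OPEN.
-/

noncomputable section

open Filter Topology Metric Set Complex Polynomial
open Literature.ModelTheory.Zilber
open Literature.Geometry.Symplectic.RotationBranch (norm_pow_sub_pow_le)

set_option linter.dupNamespace false

namespace Summit.Schanuel.Schanuel.Theorems

/-! ## Part A. Coefficient tails -/

/-- `‖q(z) - [zⁿ]q · zⁿ‖ ≤ (Σ‖qᵢ‖ + Σ‖(eraseLead q)ᵢ‖) M^{n-1}` for `deg q ≤ n`, `1 ≤ M`, `‖z‖ ≤ M`. -/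
theorem norm_eval_sub_coeff_mul_pow_le (q : Polynomial ℂ) {n : ℕ} (hq : q.natDegree ≤ n) {z : ℂ}
    {M : ℝ} (hM : 1 ≤ M) (hz : ‖z‖ ≤ M) :
    ‖q.eval z - q.coeff n * z ^ n‖ ≤ (coeffNormSum q + coeffNormSum q.eraseLead) * M ^ (n - 1) := by
  have hc0 := coeffNormSum_nonneg q
  have hc1 := coeffNormSum_nonneg q.eraseLead
  rcases hq.lt_or_eq with hlt | heq
  · rw [Polynomial.coeff_eq_zero_of_natDegree_lt hlt, zero_mul, sub_zero]
    calc ‖q.eval z‖ ≤ coeffNormSum q * M ^ (n - 1) :=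
          norm_eval_le_of_natDegree_le q hM hz (by omega)
      _ ≤ (coeffNormSum q + coeffNormSum q.eraseLead) * M ^ (n - 1) := by
          have : 0 ≤ M ^ (n - 1) := by positivity
          nlinarith
  · have he : q.eval z - q.coeff n * z ^ n = q.eraseLead.eval z := by
      rw [eval_eq_eraseLead_add q z, ← heq, Polynomial.coeff_natDegree]; ring
    rw [he]
    calc ‖q.eraseLead.eval z‖ ≤ coeffNormSum q.eraseLead * M ^ (n - 1) :=
          norm_eval_le_of_natDegree_le _ hM hz ((Polynomial.eraseLead_natDegree_le q).trans (by omega))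
      _ ≤ (coeffNormSum q + coeffNormSum q.eraseLead) * M ^ (n - 1) := by
          have : 0 ≤ M ^ (n - 1) := by positivity
          nlinarith

/-- **Coefficient ratio in the local coordinate**: for `deg q ≤ n`, `‖z₀‖ ≥ 1`, `‖z - z₀‖ ≤ 1`,
`‖q(z)/z₀ⁿ - [zⁿ]q‖ ≤ K_q/‖z₀‖` with `K_q = (Σ‖qᵢ‖ + Σ‖(eraseLead q)ᵢ‖ + n‖[zⁿ]q‖)·2ⁿ`. (new) -/
theorem norm_eval_div_pow_sub_coeff_le (q : Polynomial ℂ) {n : ℕ} (hq : q.natDegree ≤ n)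
    {z z₀ : ℂ} (hz₀ : 1 ≤ ‖z₀‖) (hz : ‖z - z₀‖ ≤ 1) :
    ‖q.eval z / z₀ ^ n - q.coeff n‖ ≤
      (coeffNormSum q + coeffNormSum q.eraseLead + n * ‖q.coeff n‖) * 2 ^ n / ‖z₀‖ := by
  have hc0 := coeffNormSum_nonneg q
  have hc1 := coeffNormSum_nonneg q.eraseLead
  have hz₀pos : 0 < ‖z₀‖ := by linarith
  have hz₀0 : z₀ ≠ 0 := norm_pos_iff.1 hz₀pos
  rcases Nat.eq_zero_or_pos n with hn | hn
  · subst hn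
    have hq0 : q.natDegree = 0 := by omega
    have hC : q.eval z = q.coeff 0 := by
      rw [Polynomial.eq_C_of_natDegree_eq_zero hq0]; simp
    rw [pow_zero, div_one, hC, sub_self, norm_zero]
    exact div_nonneg (mul_nonneg (add_nonneg (add_nonneg hc0 hc1) (by positivity)) (by positivity))
      (norm_nonneg _)
  · have hM : (1 : ℝ) ≤ 2 * ‖z₀‖ := by linarith
    have hzM : ‖z‖ ≤ 2 * ‖z₀‖ := by
      have := norm_le_insert' z z₀; linarith
    have hz₀M : ‖z₀‖ ≤ 2 * ‖z₀‖ := by linarith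
    have h1 := norm_eval_sub_coeff_mul_pow_le q hq hM hzM
    have h2 : ‖q.coeff n * z ^ n - q.coeff n * z₀ ^ n‖ ≤ ‖q.coeff n‖ * (n * (2 * ‖z₀‖) ^ (n - 1)) := by
      rw [← mul_sub, norm_mul]
      refine mul_le_mul_of_nonneg_left ?_ (norm_nonneg _)
      have := norm_pow_sub_pow_le hzM hz₀M n
      calc ‖z ^ n - z₀ ^ n‖ ≤ n * (2 * ‖z₀‖) ^ (n - 1) * ‖z - z₀‖ := this
        _ ≤ n * (2 * ‖z₀‖) ^ (n - 1) * 1 := by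
            exact mul_le_mul_of_nonneg_left hz (by positivity)
        _ = n * (2 * ‖z₀‖) ^ (n - 1) := by ring
    have h3 : ‖q.eval z - q.coeff n * z₀ ^ n‖ ≤
        (coeffNormSum q + coeffNormSum q.eraseLead + n * ‖q.coeff n‖) * (2 * ‖z₀‖) ^ (n - 1) := by
      have e : q.eval z - q.coeff n * z₀ ^ n =
          (q.eval z - q.coeff n * z ^ n) + (q.coeff n * z ^ n - q.coeff n * z₀ ^ n) := by ring
      rw [e]
      refine (norm_add_le _ _).trans ?_
      nlinarith [h1, h2]
    have hpow : (2 * ‖z₀‖) ^ (n - 1) * ‖z₀‖ ≤ 2 ^ n * ‖z₀‖ ^ n := by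
      have en : n = (n - 1) + 1 := by omega
      conv_rhs => rw [en, pow_succ, pow_succ]
      rw [mul_pow]
      have : 0 ≤ (2 : ℝ) ^ (n - 1) * ‖z₀‖ ^ (n - 1) * ‖z₀‖ := by positivity
      nlinarith
    have hdiv : q.eval z / z₀ ^ n - q.coeff n = (q.eval z - q.coeff n * z₀ ^ n) / z₀ ^ n := by
      field_simp
    rw [hdiv, norm_div, norm_pow, div_le_div_iff₀ (by positivity) hz₀pos]
    calc ‖q.eval z - q.coeff n * z₀ ^ n‖ * ‖z₀‖
        ≤ (coeffNormSum q + coeffNormSum q.eraseLead + n * ‖q.coeff n‖) * (2 * ‖z₀‖) ^ (n - 1) * ‖z₀‖ :=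
          mul_le_mul_of_nonneg_right h3 (norm_nonneg _)
      _ ≤ (coeffNormSum q + coeffNormSum q.eraseLead + n * ‖q.coeff n‖) * 2 ^ n * ‖z₀‖ ^ n := by
          have hT : 0 ≤ coeffNormSum q + coeffNormSum q.eraseLead + n * ‖q.coeff n‖ := by positivity
          rw [mul_assoc, mul_assoc]
          exact mul_le_mul_of_nonneg_left hpow hT

/-- `C (a + b k)^N e^{-c k} → 0` along `k → ∞` in the form used below: for `Λ_j → ∞`,
`(2 + 3Λ_j)^N · e^{δ(1 - (3/16)Λ_j)} → 0`. -/
theorem tendsto_pow_mul_exp_escape {Λ : ℕ → ℝ} (hΛ : Tendsto Λ atTop atTop) (N : ℕ) {δ : ℝ}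
    (hδ : 0 < δ) :
    Tendsto (fun j => (2 + 3 * Λ j) ^ N * Real.exp (δ * (1 - (3 / 16) * Λ j))) atTop (𝓝 0) := by
  -- substitute `x = (3δ/16) Λ`: the expression is `(2 + (16/δ) x)^N e^{δ} e^{-x}`
  have h1 : Tendsto (fun x : ℝ => (2 + 16 / δ * x) ^ N * Real.exp (-x)) atTop (𝓝 0) := by
    have hb : Tendsto (fun x : ℝ => x ^ N * Real.exp (-x)) atTop (𝓝 0) :=
      Real.tendsto_pow_mul_exp_neg_atTop_nhds_zero N
    -- `(2 + c x)^N ≤ (c + 2)^N x^N` for `x ≥ 1`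
    have hc : 0 < 16 / δ := by positivity
    refine squeeze_zero_norm' ?_ (by simpa using hb.const_mul ((16 / δ + 2) ^ N))
    filter_upwards [eventually_ge_atTop 1] with x hx
    rw [Real.norm_eq_abs, abs_of_nonneg (by positivity)]
    have hle : 2 + 16 / δ * x ≤ (16 / δ + 2) * x := by nlinarith
    calc (2 + 16 / δ * x) ^ N * Real.exp (-x) ≤ ((16 / δ + 2) * x) ^ N * Real.exp (-x) :=
          mul_le_mul_of_nonneg_right (pow_le_pow_left₀ (by positivity) hle N) (Real.exp_nonneg _)
      _ = (16 / δ + 2) ^ N * (x ^ N * Real.exp (-x)) := by rw [mul_pow]; ring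
  have h2 : Tendsto (fun j => (3 * δ / 16) * Λ j) atTop atTop := hΛ.const_mul_atTop (by positivity)
  have h3 := (h1.comp h2).const_mul (Real.exp δ)
  rw [mul_zero] at h3
  refine h3.congr fun j => ?_
  simp only [Function.comp_apply]
  have e1 : 2 + 16 / δ * (3 * δ / 16 * Λ j) = 2 + 3 * Λ j := by field_simp
  have e2 : Real.exp (δ * (1 - 3 / 16 * Λ j)) = Real.exp δ * Real.exp (-(3 * δ / 16 * Λ j)) := by
    rw [← Real.exp_add]; congr 1; ring
  rw [e1, e2]; ring

end Summit.Schanuel.Schanuel.Theorems
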